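import Summits.BirchSwinnertonDyer.Rank1Residual.P2.CMKolyvaginCMIsogenyAtTwoInvolution
import Summits.BirchSwinnertonDyer.BirchSwinnertonDyer.Theorems.GenusKolyvaginAtTwoEquivariantKolyvaginExactAtTwoTwistInfRes
import Literature.NumberTheory.EllipticCurves.SelmerTorsionBaseChangeCongr
import HarnessLib

/-!
# `P2` typed interface (cell `bsd-print-cf2`, seat ty2): the SELMER DESCENT `Sel_{2^M}(E/K) ≅ Sel_{2^M}(E_L/L)^{σ}`
# over the Morita tower `ℚ ⊂ K ⊂ L` — MEMO stub S2 reduced to EXACT LOCAL DESCENT, and the output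
# `#Sel_{2^M}(E_L/L) = (#Sel_{2^M}(E_K/K))²` on `H₂`

Route `CMKolyvaginAtInertTwo`, crux `CMKolyvaginExactAtInertTwo` (stmt-BirchSwinnertonDyer-24277); MEMO
`Cruxes/CMExactDescentAtTwo/MEMO-inert-order-splitting.md` §5/§6 stub **S2** «descent `L → K_H`:
`Sel_{2^M}(E/K_H) ↪ Sel_{2^M}(E/L)^{σ'}` (inf–res over the base `K_H`; the tree's finite-level inf–res … are
typed for base `ℚ` only) and its image (local descent)». THEOREMS ONLY (0 defs / 0 facts / 0 sorry); no
item is closed; BSD is not proved by this.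

§1 GENERIC, any `E = W/K` over a number field, any finite GALOIS `L/K`, any `n` (the relative finite-level
bookkeeping is ty2's Literature `SelmerTorsionRelModelAction`, p659311; the sharp inflation–restriction is
gk2-p3's `GenusExact.TwistInfRes.mem_range_resSubgroupH1_iff_forall_conjH1_eq`):
* `mem_range_resTorsion_iff_forall_conjAct_eq` — when `E[n]^{galRange L} = 0`:
  **`res H¹(K, E[n]) = H¹(L, E_L[n])^{Gal(L/K)}`** (and `res` is injective,
  `RelModel.resTorsion_injective_of_fixedPoints_eq_bot`).
* `natCard_selmerGroup_eq_natCard_fixed_of_descent` — GRANTED the exact local descent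
  `hdesc : res x ∈ Sel^(n)(E_L/L) ⟹ x ∈ Sel^(n)(E/K)` (the only non-formal input; ty2's next Literature
  file discharges it place by place): **`#Sel^(n)(E/K) = #Sel^(n)(E_L/L)^{Gal(L/K)}`**; for `[L : K] = 2`,
  `σ₀ ≠ 1`: `natCard_selmerGroup_eq_natCard_fixed_of_descent_of_finrank_eq_two` (`= #Sel^(n)(E_L/L)^{σ₀}`).

§2 THE `2`-POWER LEVEL: `fixedPoints_galRange_eq_bot_of_two_pow` — a `Γ_L`-element without non-zero fixed
point on `E_L[2]` (cmk2's `3`-cycle) kills `E[2^M]^{galRange L}` for every `M`.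

§3 `H₂` OVER THE TOWER (`E/ℚ` with CM, `2` inert in `F`, `ρ̄_{E,2}` onto; `K` quadratic; `L ⊇ K`,
`[L : K] = 2`, totally complex, `√d_F ∈ L`; `σ ∈ Gal(L/K)`, `σ ≠ 1`, moving a square root of `Δ_E`):
* `natCard_selmer_baseChange_eq_natCard_fixed_of_descent` — **`#Sel_{2^M}(E_K/K) =
  #{y ∈ Sel_{2^M}((E_K)_L/L) : σ · y = y}`** granted `hdesc` (inf–res is binder-free here:
  `exists_fixedPointFree_two_of_tower`);
* `natCard_selmer_baseChange_tower_eq_sq_of_descent` — with ty2 g28's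
  `CMIsogenyAtTwo.natCard_selmer_eq_sq_of_neg_sqrt_of_tower` (`#Sel_{2^M}(E_L/L) = (#Sel^{σ})²`) and the
  Literature bridge `natCard_selmerGroup_fixed_conjAct_tower` (`(E_K)_L = E_L`, `conjAct (W⁄K) σ` versus
  `conjAct W σ|_ℚ`): **`#Sel_{2^M}(E_L/L) = (#Sel_{2^M}(E_K/K))²`** granted `hdesc` — MEMO §5 S2's
  «`#Sel_{2^M}(E/L) = (#Sel_{2^M}(E/K))²·(p_F-defect)`» with the defect the single displayed binder.

beyond-print theorem: NO (Serre, *Galois Cohomology* I §2.6 (b); Dokchitser–Dokchitser 2010 Lemma 4.14).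
BSD is not proved by any of this; no summit statement is proved by this seat.

References: [SerreGaloisCohomology1997] I §2.6 (b); [DokchitserDokchitserAnnals2010] Lemma 4.14 (proof);
[GrossLMS1991] §5 (5.1); [Lang1987] Ch. 10 §4.
-/

set_option autoImplicit false

noncomputable section

open scoped Classical

namespace Summit.BirchSwinnertonDyer.Rank1Residual.P2.SelmerDescentAtTwo

open WeierstrassCurve Field NumberField
open Literature.NumberTheory.EllipticCurves Literature.NumberTheory.EllipticCurves.Rank1Residual
open Literature.NumberTheory.GaloisRepresentations
open Summit.BirchSwinnertonDyer.BirchSwinnertonDyer.Theorems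

/-! ## §1 Generic: `res H¹(K, E[n]) = H¹(L, E_L[n])^{Gal(L/K)}` and the Selmer count modulo local descent -/

section Generic

variable {K L : Type} [Field K] [NumberField K] [Field L] [NumberField L] [Algebra K L]
variable (W : WeierstrassCurve K) (n : ℤ)

omit [NumberField K] in
/-- The `Γ_K`-orbit maps of `E[n]` are continuous (discrete coefficients: open stabilizers). [folklore] -/
private theorem continuous_smul_geomTorsion (m : geomTorsion W n) :
    Continuous fun g : absoluteGaloisGroup K ↦ g • m :=
  continuous_induced_rng.2 (by
    change Continuous fun g : absoluteGaloisGroup K ↦ ((g • m : geomTorsion W n) : geomPoints W)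
    simp only [AddSubgroup.torsionBy.coe_smul]
    exact continuous_smul_of_isOpen_stabilizer (m : geomPoints W) (isOpen_stabilizer_point_holds W _))

variable (L)

/-- **Inflation–restriction, image form, over a Galois base extension `L/K` at finite level**: when no
non-zero point of `E[n]` is fixed by `galRange L` (`E_L[n](L) = 0`), a class of `H¹(L, E_L[n])` is a
restriction from `K` iff it is fixed by every `σ ∈ Gal(L/K)` — gk2-p3's absolute-model theorem transported
along `modelIsoTorsion` / `RelModel.modelIsoTorsion_conjAct`, the transported lifts being coset
representatives of `galRange L` (`RelModel.exists_liftToAbsGal_inv_mul_mem_galRange`). With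
`RelModel.resTorsion_injective_of_fixedPoints_eq_bot`: `res : H¹(K, E[n]) ≅ H¹(L, E_L[n])^{Gal(L/K)}`.
[cite: SerreGaloisCohomology1997, I §2.6 (b)] [cite: DokchitserDokchitserAnnals2010, Lemma 4.14 (proof)] -/
theorem mem_range_resTorsion_iff_forall_conjAct_eq [IsGalois K L]
    (hfix : FixedPoints.addSubgroup (galRange (K := K) L) (geomTorsion W n) = ⊥)
    (y : galH1Torsion (W.baseChange L) n) :
    y ∈ (resTorsion W L n).range ↔ ∀ σ : L ≃ₐ[K] L, conjAct W σ n y = y := by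
  haveI := RelModel.normal_galRange (K := K) L
  constructor
  · rintro ⟨x, rfl⟩ σ
    exact RelModel.conjAct_resTorsion L W n σ x
  · intro hy
    set y' := modelIsoTorsion L W n y with hy'
    have hfix1 : ∀ σ : L ≃ₐ[K] L,
        conjH1 (galRange (K := K) L) (geomTorsion W n) (liftToAbsGal (K := K) L σ) y' = y' := fun σ ↦ by
      rw [hy', ← RelModel.modelIsoTorsion_conjAct L W n σ, hy σ]
    have hall : ∀ g : absoluteGaloisGroup K,
        conjH1 (galRange (K := K) L) (geomTorsion W n) g y' = y' := fun g ↦ by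
      obtain ⟨σ, hσ⟩ := RelModel.exists_liftToAbsGal_inv_mul_mem_galRange (K := K) L g
      have hg : g = liftToAbsGal (K := K) L σ * ((liftToAbsGal (K := K) L σ)⁻¹ * g) := by
        rw [mul_inv_cancel_left]
      rw [hg, conjH1_mul_of_mem (galRange (K := K) L) _ hσ, hfix1 σ]
    obtain ⟨x, hx⟩ := (GenusExact.TwistInfRes.mem_range_resSubgroupH1_iff_forall_conjH1_eq
      (galRange (K := K) L) (isOpen_galRange L) (continuous_smul_geomTorsion W n) hfix y').mpr hall
    refine ⟨x, (modelIsoTorsion L W n).injective ?_⟩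
    rw [modelIsoTorsion_resTorsion, hx]

/-- **`#Sel^(n)(E/K) = #Sel^(n)(E_L/L)^{Gal(L/K)}` GRANTED EXACT LOCAL DESCENT.** For `L/K` finite Galois
with `E[n]^{galRange L} = 0`, restriction is a bijection from `Sel^(n)(E/K)` onto the `Gal(L/K)`-fixed
classes of `Sel^(n)(E_L/L)`: injective (`RelModel.resTorsion_injective_of_fixedPoints_eq_bot`), into Selmer
(`resTorsion_mem_selmerGroup`) and invariant (`RelModel.conjAct_resTorsion`), and onto by
`mem_range_resTorsion_iff_forall_conjAct_eq` together with the displayed binder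
`hdesc : res x ∈ Sel^(n)(E_L/L) ⟹ x ∈ Sel^(n)(E/K)` (exact local descent at every place — automatic at
split places and unramified good places, Milne ADT I.3.8; the content of Dokchitser–Dokchitser's
"cokernel killed by `|G|²`" where the local terms vanish).
[cite: DokchitserDokchitserAnnals2010, Lemma 4.14 (proof)] [cite: SerreGaloisCohomology1997, I §2.6 (b)] -/
theorem natCard_selmerGroup_eq_natCard_fixed_of_descent [IsGalois K L]
    (hfix : FixedPoints.addSubgroup (galRange (K := K) L) (geomTorsion W n) = ⊥)
    (hdesc : ∀ x : galH1Torsion W n,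
      resTorsion W L n x ∈ selmerGroup (W.baseChange L) n → x ∈ selmerGroup W n) :
    Nat.card (selmerGroup W n) =
      Nat.card {y : selmerGroup (W.baseChange L) n //
        ∀ σ : L ≃ₐ[K] L, conjAct W σ n (y : galH1Torsion (W.baseChange L) n) = y} := by
  let f : selmerGroup W n → {y : selmerGroup (W.baseChange L) n //
      ∀ σ : L ≃ₐ[K] L, conjAct W σ n (y : galH1Torsion (W.baseChange L) n) = y} :=
    fun x ↦ ⟨⟨resTorsion W L n x, resTorsion_mem_selmerGroup W L n x.2⟩,
      fun σ ↦ RelModel.conjAct_resTorsion L W n σ x⟩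
  have hinj : Function.Injective f := fun a b h ↦
    Subtype.ext (RelModel.resTorsion_injective_of_fixedPoints_eq_bot L W n hfix
      (congrArg (fun z ↦ ((z.1 : selmerGroup (W.baseChange L) n) : galH1Torsion (W.baseChange L) n)) h))
  have hsurj : Function.Surjective f := fun y ↦ by
    obtain ⟨x, hx⟩ := (mem_range_resTorsion_iff_forall_conjAct_eq L W n hfix _).mpr y.2
    have hxS : x ∈ selmerGroup W n := hdesc x (by rw [hx]; exact y.1.2)
    exact ⟨⟨x, hxS⟩, Subtype.ext (Subtype.ext hx)⟩
  exact Nat.card_congr (Equiv.ofBijective f ⟨hinj, hsurj⟩)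

/-- **`#Sel^(n)(E/K) = #Sel^(n)(E_L/L)^{σ₀}` for `[L : K] = 2`, `σ₀ ≠ 1`, granted exact local descent**
(`RelModel.forall_conjAct_eq_iff_of_finrank_eq_two`). [cite: GrossLMS1991, §5 (5.1)]
[cite: DokchitserDokchitserAnnals2010, Lemma 4.14 (proof)] -/
theorem natCard_selmerGroup_eq_natCard_fixed_of_descent_of_finrank_eq_two
    (h2 : Module.finrank K L = 2) {σ₀ : L ≃ₐ[K] L} (hσ₀ : σ₀ ≠ 1)
    (hfix : FixedPoints.addSubgroup (galRange (K := K) L) (geomTorsion W n) = ⊥)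
    (hdesc : ∀ x : galH1Torsion W n,
      resTorsion W L n x ∈ selmerGroup (W.baseChange L) n → x ∈ selmerGroup W n) :
    Nat.card (selmerGroup W n) =
      Nat.card {y : selmerGroup (W.baseChange L) n //
        conjAct W σ₀ n (y : galH1Torsion (W.baseChange L) n) = y} := by
  haveI : Algebra.IsQuadraticExtension K L := ⟨h2⟩
  haveI : IsGalois K L := inferInstance
  rw [natCard_selmerGroup_eq_natCard_fixed_of_descent L W n hfix hdesc]
  exact Nat.card_congr (Equiv.subtypeEquivRight fun y ↦
    RelModel.forall_conjAct_eq_iff_of_finrank_eq_two L W n σ₀ h2 hσ₀ _)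

/-! ## §2 The `2`-power level: `E[2^M]^{galRange L} = 0` from a fixed-point-free element on `E_L[2]` -/

omit [NumberField K] [NumberField L] in
/-- **`E[2^M]^{galRange L} = 0`** as soon as some `z ∈ Γ_L` has no non-zero fixed point on `E_L[2]`: a
fixed `2^M`-torsion point is killed by `2^M`, and `z` peels off one factor `2` at a time (a non-zero fixed
`2`-power-torsion point would have a non-zero fixed multiple in `E_L[2]`). On `H₂` (`ρ̄_{E,2}` onto) over
the Morita tower such a `z` is cmk2's `3`-cycle `exists_fixedPointFree_two_of_tower`.
[cite: GrossLMS1991, §9 (before Prop. 9.1)] [cite: DokchitserDokchitserMathZ2012, Theorem (1)] -/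
theorem fixedPoints_galRange_eq_bot_of_two_pow {z : absoluteGaloisGroup L}
    (hz : ∀ P : geomPoints (W.baseChange L), (2 : ℤ) • P = 0 → z • P = P → P = 0) (M : ℕ) :
    FixedPoints.addSubgroup (galRange (K := K) L) (geomTorsion W ((2 : ℤ) ^ M)) = ⊥ := by
  -- `z` kills every `2`-power-torsion point it fixes
  have hkill : ∀ (j : ℕ) (Q : geomPoints (W.baseChange L)),
      ((2 : ℤ) ^ j) • Q = 0 → z • Q = Q → Q = 0 := by
    intro j
    induction j with
    | zero => intro Q hQ _; simpa using hQ
    | succ j ih =>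
      intro Q hQ hzQ
      have h2Q : ((2 : ℤ) ^ j) • ((2 : ℤ) • Q) = 0 := by
        rw [← mul_zsmul, ← pow_succ, hQ]
      have hz2Q : z • ((2 : ℤ) • Q) = (2 : ℤ) • Q := by
        rw [← DistribMulAction.toAddMonoidHom_apply, map_zsmul, DistribMulAction.toAddMonoidHom_apply, hzQ]
      exact hz Q (ih _ h2Q hz2Q) hzQ
  rw [eq_bot_iff]
  intro m hm
  rw [AddSubgroup.mem_bot]
  have hm' : ∀ g : galRange (K := K) L, g • m = m := fun g ↦
    (FixedPoints.mem_addSubgroup _ _ _).1 hm g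
  set P := torsionBaseChangeMap W L ((2 : ℤ) ^ M) m with hP
  have hPfix : z • (P : geomPoints (W.baseChange L)) = (P : geomPoints (W.baseChange L)) := by
    have h : resGal (K := K) L z • m = m := by
      have := hm' ⟨resGal (K := K) L z, ⟨z, rfl⟩⟩
      rwa [Subgroup.smul_def] at this
    rw [← AddSubgroup.torsionBy.coe_smul, ← torsionBaseChangeMap_smul, h]
  have hPtor : ((2 : ℤ) ^ M) • (P : geomPoints (W.baseChange L)) = 0 :=
    (mem_geomTorsion_iff _ _ _).mp P.2
  have hP0 : P = 0 := Subtype.ext (hkill M _ hPtor hPfix)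
  apply torsionBaseChangeMap_injective W L ((2 : ℤ) ^ M)
  rw [map_zero]
  exact hP0

end Generic

/-! ## §3 `H₂` over the Morita tower `ℚ ⊂ K ⊂ L` -/

section Tower

variable (W : WeierstrassCurve ℚ) [W.IsElliptic]
variable {K L : Type} [Field K] [NumberField K] [Field L] [NumberField L] [Algebra K L]

/-- Over the tower `ℚ ⊂ K ⊂ L` (`[K : ℚ] = 2`, `[L : K] = 2`) with `ρ̄_{E,2}` onto: **`E_K[2^M]^{galRange L} = 0`
for every `M`** — cmk2's `3`-cycle `exists_fixedPointFree_two_of_tower`, read on `(E_K)_L = E_L`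
(`baseChange_baseChange_eq`), through `fixedPoints_galRange_eq_bot_of_two_pow`.
[cite: GrossLMS1991, §9 (before Prop. 9.1)] [cite: DokchitserDokchitserMathZ2012, Theorem (1)] -/
theorem fixedPoints_galRange_two_pow_eq_bot_of_tower (hK2 : Module.finrank ℚ K = 2)
    (hsurj : W.HasSurjectiveModNGaloisRep 2) (hLK : Module.finrank K L = 2) (M : ℕ) :
    FixedPoints.addSubgroup (galRange (K := K) L) (geomTorsion (W.baseChange K) ((2 : ℤ) ^ M)) = ⊥ := by
  obtain ⟨z, hz⟩ := InertOrderSplittingHabitat.exists_fixedPointFree_two_of_tower W K hK2 hsurj L hLK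
  have hz' : ∀ P : geomPoints ((W.baseChange K).baseChange L), (2 : ℤ) • P = 0 → z • P = P → P = 0 := by
    rw [baseChange_baseChange_eq W L]
    exact hz
  exact fixedPoints_galRange_eq_bot_of_two_pow L (W.baseChange K) hz' M

/-- **`#Sel_{2^M}(E_K/K) = #{y ∈ Sel_{2^M}((E_K)_L/L) : σ · y = y}` GRANTED EXACT LOCAL DESCENT**, for
`E/ℚ` with `ρ̄_{E,2}` onto, `K` quadratic, `[L : K] = 2`, `σ ∈ Aut(L/K)`, `σ ≠ 1` — the injection
`Sel_{2^M}(E/K_H) ↪ Sel_{2^M}(E/L)^{σ'}` of MEMO stub S2 is an ISOMORPHISM onto the `σ'`-invariants modulo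
the one displayed binder `hdesc` (the inflation–restriction half is binder-free on this habitat).
[cite: SerreGaloisCohomology1997, I §2.6 (b)] [cite: DokchitserDokchitserAnnals2010, Lemma 4.14 (proof)] -/
theorem natCard_selmer_baseChange_eq_natCard_fixed_of_descent (hK2 : Module.finrank ℚ K = 2)
    (hsurj : W.HasSurjectiveModNGaloisRep 2) (hLK : Module.finrank K L = 2) {σ : L ≃ₐ[K] L} (hσ : σ ≠ 1)
    (M : ℕ)
    (hdesc : ∀ x : galH1Torsion (W.baseChange K) ((2 : ℤ) ^ M),
      resTorsion (W.baseChange K) L ((2 : ℤ) ^ M) x ∈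
          selmerGroup ((W.baseChange K).baseChange L) ((2 : ℤ) ^ M) →
        x ∈ selmerGroup (W.baseChange K) ((2 : ℤ) ^ M)) :
    Nat.card (selmerGroup (W.baseChange K) ((2 : ℤ) ^ M)) =
      Nat.card {y : selmerGroup ((W.baseChange K).baseChange L) ((2 : ℤ) ^ M) //
        conjAct (W.baseChange K) σ ((2 : ℤ) ^ M)
          (y : galH1Torsion ((W.baseChange K).baseChange L) ((2 : ℤ) ^ M)) = y} :=
  haveI : (W.baseChange K).IsElliptic := by rw [baseChange]; infer_instance
  natCard_selmerGroup_eq_natCard_fixed_of_descent_of_finrank_eq_two L (W.baseChange K) ((2 : ℤ) ^ M)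
    hLK hσ (fixedPoints_galRange_two_pow_eq_bot_of_tower W hK2 hsurj hLK M) hdesc

omit [W.IsElliptic] in
/-- Involutions of `L/K`, `[L : K] = 2`: `σ ≠ 1 ⟹ σ² = 1` (the group `Aut(L/K)` has order `2`). [folklore] -/
private theorem mul_self_eq_one_of_finrank_eq_two (hLK : Module.finrank K L = 2) (σ : L ≃ₐ[K] L) :
    σ * σ = 1 := by
  haveI : Algebra.IsQuadraticExtension K L := ⟨hLK⟩
  haveI : IsGalois K L := inferInstance
  have hcard : Nat.card (L ≃ₐ[K] L) = 2 := by rw [IsGalois.card_aut_eq_finrank, hLK]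
  rw [← pow_two, ← hcard, pow_card_eq_one']

/-- **MEMO STUB S2's OUTPUT ON `H₂`, MODULO EXACT LOCAL DESCENT:
`#Sel_{2^M}(E_L/L) = (#Sel_{2^M}(E_K/K))²`.** For `E/ℚ` with CM, `2` inert in `F`, `ρ̄_{E,2}` onto; `K`
quadratic; `L ⊇ K` with `[L : K] = 2`, totally complex, `√d_F ∈ L`; `σ ∈ Aut(L/K)`, `σ ≠ 1`, with
`σ r = −r` for some `r`, `r² = Δ_{E_L}` (e.g. `L = K·F`, `σ` the generator of `Gal(L/K)`, `√Δ_E ∈ F ∖ K`):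
ty2 g28's `#Sel_{2^M}(E_L/L) = (#Sel_{2^M}(E_L/L)^{σ})²` (`CMIsogenyAtTwo.natCard_selmer_eq_sq_of_neg_sqrt_of_tower`),
the Literature bridge `natCard_selmerGroup_fixed_conjAct_tower` (`(E_K)_L = E_L`, `conjAct (W⁄K) σ` versus
`conjAct W σ|_ℚ`) and `natCard_selmer_baseChange_eq_natCard_fixed_of_descent`. The remaining binder `hdesc`
(exact local descent of the `2^M`-Selmer condition along `L/K`) is MEMO §3 (a)'s «local norm index at the
places above `p_F`» — elsewhere Milne ADT I.3.8 / odd Tamagawa numbers.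
[cite: Lang1987, Ch. 10 §4, Remark] [cite: DokchitserDokchitserAnnals2010, Lemma 4.14 (proof)]
[cite: SerreGaloisCohomology1997, I §2.6 (b)] -/
theorem natCard_selmer_baseChange_tower_eq_sq_of_descent (hCM : W.HasCM) (hin : CMInert W 2)
    (hsurj : W.HasSurjectiveModNGaloisRep 2) (hK2 : Module.finrank ℚ K = 2) (hLK : Module.finrank K L = 2)
    (hLc : ∀ w : InfinitePlace L, w.IsComplex) (hF : IsSquare (algebraMap ℚ L (cmFieldDiscrOfJ W.j)))
    {σ : L ≃ₐ[K] L} (hσ : σ ≠ 1) {r : L} (hr : r ^ 2 = (W.baseChange L).Δ) (hσr : σ r = -r) (M : ℕ)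
    (hdesc : ∀ x : galH1Torsion (W.baseChange K) ((2 : ℤ) ^ M),
      resTorsion (W.baseChange K) L ((2 : ℤ) ^ M) x ∈
          selmerGroup ((W.baseChange K).baseChange L) ((2 : ℤ) ^ M) →
        x ∈ selmerGroup (W.baseChange K) ((2 : ℤ) ^ M)) :
    Nat.card (selmerGroup (W.baseChange L) ((2 : ℤ) ^ M)) =
      Nat.card (selmerGroup (W.baseChange K) ((2 : ℤ) ^ M)) ^ 2 := by
  have hσσ : σ.restrictScalars ℚ * σ.restrictScalars ℚ = 1 := by
    have h := mul_self_eq_one_of_finrank_eq_two hLK σ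
    ext x
    change σ (σ x) = x
    exact congrArg (fun τ : L ≃ₐ[K] L ↦ τ x) h
  have hσr' : σ.restrictScalars ℚ r = -r := hσr
  rw [CMIsogenyAtTwo.natCard_selmer_eq_sq_of_neg_sqrt_of_tower W hCM hin hsurj K hK2 hLK hLc hF hσσ hr
      hσr' M,
    ← natCard_selmerGroup_fixed_conjAct_tower W σ ((2 : ℤ) ^ M) (baseChange_baseChange_eq W L),
    ← natCard_selmer_baseChange_eq_natCard_fixed_of_descent W hK2 hsurj hLK hσ M hdesc]

/-- **The same with `K` imaginary quadratic** (the Heegner field `K_H` of the crux; `hK.1 : [K : ℚ] = 2`).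
[cite: Lang1987, Ch. 10 §4, Remark] [cite: DokchitserDokchitserAnnals2010, Lemma 4.14 (proof)] -/
theorem natCard_selmer_baseChange_tower_eq_sq_of_descent_of_isImaginaryQuadratic (hCM : W.HasCM)
    (hin : CMInert W 2) (hsurj : W.HasSurjectiveModNGaloisRep 2) (hK : IsImaginaryQuadratic K)
    (hLK : Module.finrank K L = 2) (hLc : ∀ w : InfinitePlace L, w.IsComplex)
    (hF : IsSquare (algebraMap ℚ L (cmFieldDiscrOfJ W.j)))
    {σ : L ≃ₐ[K] L} (hσ : σ ≠ 1) {r : L} (hr : r ^ 2 = (W.baseChange L).Δ) (hσr : σ r = -r) (M : ℕ)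
    (hdesc : ∀ x : galH1Torsion (W.baseChange K) ((2 : ℤ) ^ M),
      resTorsion (W.baseChange K) L ((2 : ℤ) ^ M) x ∈
          selmerGroup ((W.baseChange K).baseChange L) ((2 : ℤ) ^ M) →
        x ∈ selmerGroup (W.baseChange K) ((2 : ℤ) ^ M)) :
    Nat.card (selmerGroup (W.baseChange L) ((2 : ℤ) ^ M)) =
      Nat.card (selmerGroup (W.baseChange K) ((2 : ℤ) ^ M)) ^ 2 :=
  natCard_selmer_baseChange_tower_eq_sq_of_descent W hCM hin hsurj hK.1 hLK hLc hF hσ hr hσr M hdesc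

end Tower

end Summit.BirchSwinnertonDyer.Rank1Residual.P2.SelmerDescentAtTwo
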